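import Summits.SmoothPoincare4.SmoothPoincare4.Theorems.RootDecompAEDoublesBeyondShadowTwoLedgerBlocks

/-!
# Grade-four ownership ledger `LocalTableLE4 → GradeFourDichotomy` for KMN encoding graphs, part 8/15: exponent sums of the relators; rows and used letters

§8 Substitution and exponent lemmas for port words and gluing relators (`lift_gluingRelator`,
`expo_inl_gluingRelator`); §9a the exponent table `tab`, the used letters `cols R` (`cols_singleton_card` for ranks `≤
5`) and the rows `rows R L` of a peeling state.

THE FAMILY (14 modules `Theorems/RootDecompAEDoublesBeyondShadowTwoLedger*.lean` + the closing module
`Theorems/RootDecompAEDoublesBeyondShadowTwoStubLedgerFour.lean`, one namespace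
`Summit.SmoothPoincare4.SmoothPoincare4.Theorems.RootDecompAEDoublesBeyondShadowTwoStubLedgerFour`, linearly chained
imports, split by topic to respect the 400-line bound on proof files).
-/

open Function
open Literature.Topology.FourManifolds

set_option linter.dupNamespace false

noncomputable section

namespace Summit.SmoothPoincare4.SmoothPoincare4.Theorems.RootDecompAEDoublesBeyondShadowTwoStubLedgerFour

/-! ## §8 Exponent sums and substitutions in the relators of `P(G₄)` -/

section GraphAlgebra

variable {ι₄ : Type} [DecidableEq ι₄]

/-- Exponent sums are transported along an injective renaming of the letters. -/
theorem expo_map_injective₄ {κ : Type} [DecidableEq κ] (f : ι₄ → κ) (hf : Function.Injective f) (i : ι₄)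
    (w₄ : FreeGroup ι₄) : expo i w₄ = expo (f i) (FreeGroup.map f w₄) := by
  symm
  have h : (gexp (f i)).comp (FreeGroup.map f) = gexp i := by
    refine FreeGroup.ext_hom _ _ fun i' => ?_
    simp only [MonoidHom.coe_comp, Function.comp_apply, FreeGroup.map.of, gexp, FreeGroup.lift_apply_of]
    by_cases hii : i' = i
    · simp [hii]
    · simp [hii, hf.ne hii]
  unfold expo
  exact congrArg Multiplicative.toAdd (DFunLike.congr_fun h w₄)

omit [DecidableEq ι₄] in
/-- A letter outside the image of a renaming has exponent sum zero in every renamed word. -/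
theorem expo_map_eq_zero₄ {κ : Type} [DecidableEq κ] (f : ι₄ → κ) (w₄ : FreeGroup ι₄) (j : κ)
    (hj : ∀ i, f i ≠ j) : expo j (FreeGroup.map f w₄) = 0 := by
  have h : (gexp j).comp (FreeGroup.map f) = 1 := by
    refine FreeGroup.ext_hom _ _ fun i' => ?_
    simp [gexp, hj i']
  unfold expo
  have := DFunLike.congr_fun h w₄
  simp only [MonoidHom.coe_comp, Function.comp_apply, MonoidHom.one_apply] at this
  rw [this]
  rfl

omit [DecidableEq ι₄] in
/-- Substitution after renaming is substitution of the composite. -/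
theorem lift_map_eq₄ {κ H : Type} [Group H] (F : κ → H) (f : ι₄ → κ) (w₄ : FreeGroup ι₄) :
    FreeGroup.lift (F ∘ f) w₄ = FreeGroup.lift F (FreeGroup.map f w₄) := by
  symm
  have h : (FreeGroup.lift F).comp (FreeGroup.map f) = FreeGroup.lift (F ∘ f) :=
    FreeGroup.ext_hom _ _ fun i => by simp
  exact DFunLike.congr_fun h w₄

omit [DecidableEq ι₄] in
/-- A homomorphism applied after a substitution is the substitution of the composite. -/
theorem hom_lift_eq₄ {H H' : Type} [Group H] [Group H'] (φ : H →* H') (f : ι₄ → H) (w₄ : FreeGroup ι₄) :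
    FreeGroup.lift (φ ∘ f) w₄ = φ (FreeGroup.lift f w₄) := by
  symm
  have h : φ.comp (FreeGroup.lift f) = FreeGroup.lift (φ ∘ f) := FreeGroup.ext_hom _ _ fun i => by simp
  exact DFunLike.congr_fun h w₄

omit [DecidableEq ι₄] in
/-- Substituting `1` for every letter kills the word. -/
theorem lift_const_one₄ {H : Type} [Group H] (w₄ : FreeGroup ι₄) :
    (1 : H) = FreeGroup.lift (fun _ : ι₄ => (1 : H)) w₄ := by
  symm
  have h : FreeGroup.lift (fun _ : ι₄ => (1 : H)) = 1 := FreeGroup.ext_hom _ _ fun i => by simp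
  rw [h]
  rfl

omit [DecidableEq ι₄] in
/-- Homomorphisms commute with the optional inversion `sgnw`. -/
theorem hom_sgnw₄ {κ : Type} (t : Bool) (f : FreeGroup ι₄ →* FreeGroup κ) (w₄ : FreeGroup ι₄) :
    f (sgnw t w₄) = sgnw t (f w₄) := by
  cases t <;> simp [sgnw]

end GraphAlgebra


namespace ShadowGraph

variable (G₄ : ShadowGraph)

/-- The letters of piece `v`. -/
def ltr (v : Fin G₄.k) : Fin 5 → G₄.Gen := fun i => Sum.inl (v, i)

/-- The spine letters of one piece are distinct. -/
theorem ltr_injective₄ (v : Fin G₄.k) : Function.Injective (G₄.ltr v) := by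
  intro i j h
  simpa [ltr] using h

/-- `embed v` is the renaming `i ↦ x_(v, i)`. -/
theorem embed_apply (v : Fin G₄.k) (w : FreeGroup (Fin 5)) : G₄.embed v w = FreeGroup.map (G₄.ltr v) w := rfl

/-- Substitution into a port word placed at piece `v` is substitution of the `v`-letters into the port word. -/
theorem lift_portWordAt₄ {H : Type} [Group H] (F : G₄.Gen → H) (p : Fin G₄.k × ℕ) :
    FreeGroup.lift F (G₄.portWordAt p) = FreeGroup.lift (F ∘ G₄.ltr p.1) ((G₄.piece p.1).portWord p.2) := by
  unfold ShadowGraph.portWordAt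
  rw [embed_apply, ← lift_map_eq₄]

/-- Exponent sum of a spine letter `x_(v, i)` in a port word placed at a piece: zero away from `v`. -/
theorem expo_inl_portWordAt (v : Fin G₄.k) (i : Fin 5) (p : Fin G₄.k × ℕ) :
    expo (Sum.inl (v, i)) (G₄.portWordAt p) = if p.1 = v then expo i ((G₄.piece p.1).portWord p.2) else 0 := by
  unfold ShadowGraph.portWordAt
  rw [embed_apply]
  split_ifs with h
  · have : (Sum.inl (v, i) : G₄.Gen) = G₄.ltr p.1 i := by simp [ltr, h]
    rw [this, ← expo_map_injective₄ _ (G₄.ltr_injective₄ _)]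
  · exact expo_map_eq_zero₄ _ _ _ (fun i' => by simp [ltr, h])

/-- The orientation sign of the `e`-th gluing as an integer. -/
def osgn (e : Fin G₄.m) : ℤ := if G₄.sgn e then 1 else -1

/-- The orientation sign `±1` is a unit. -/
theorem isUnit_osgn₄ (e : Fin G₄.m) : IsUnit (G₄.osgn e) := by
  unfold osgn; split_ifs <;> simp

/-- THE EXPONENT TABLE ENTRY of a spine letter in a gluing relator: source port word plus signed target port word. -/
theorem expo_inl_gluingRelator (v : Fin G₄.k) (i : Fin 5) (e : Fin G₄.m) :
    expo (Sum.inl (v, i)) (G₄.gluingRelator e) =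
      expo (Sum.inl (v, i)) (G₄.portWordAt (G₄.src e)) + G₄.osgn e * expo (Sum.inl (v, i)) (G₄.portWordAt (G₄.tgt e)) := by
  unfold ShadowGraph.gluingRelator ShadowGraph.stable osgn
  cases G₄.sgn e <;> simp

/-- EVALUATION of a substitution on a gluing relator. -/
theorem lift_gluingRelator₄ {β : Type} (F : G₄.Gen → FreeGroup β) (e : Fin G₄.m) :
    FreeGroup.lift F (G₄.gluingRelator e) =
      FreeGroup.lift (F ∘ G₄.ltr (G₄.src e).1) ((G₄.piece (G₄.src e).1).portWord (G₄.src e).2) * F (Sum.inr e) *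
        sgnw (!G₄.sgn e) (FreeGroup.lift (F ∘ G₄.ltr (G₄.tgt e).1) ((G₄.piece (G₄.tgt e).1).portWord (G₄.tgt e).2)) *
          (F (Sum.inr e))⁻¹ := by
  unfold ShadowGraph.gluingRelator ShadowGraph.stable
  cases G₄.sgn e <;> simp [sgnw, lift_portWordAt₄]

/-- Two substitutions that agree on the letters of the two end pieces and on the stable letter of a gluing agree on
its relator. -/
theorem lift_gluingRelator_congr₄ {β : Type} (F F' : G₄.Gen → FreeGroup β) (e : Fin G₄.m)
    (hs : ∀ i, F (Sum.inl ((G₄.src e).1, i)) = F' (Sum.inl ((G₄.src e).1, i)))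
    (ht : ∀ i, F (Sum.inl ((G₄.tgt e).1, i)) = F' (Sum.inl ((G₄.tgt e).1, i)))
    (he : F (Sum.inr e) = F' (Sum.inr e)) :
    FreeGroup.lift F (G₄.gluingRelator e) = FreeGroup.lift F' (G₄.gluingRelator e) := by
  rw [lift_gluingRelator₄, lift_gluingRelator₄, he]
  have h1 : F ∘ G₄.ltr (G₄.src e).1 = F' ∘ G₄.ltr (G₄.src e).1 := funext fun i => hs i
  have h2 : F ∘ G₄.ltr (G₄.tgt e).1 = F' ∘ G₄.ltr (G₄.tgt e).1 := funext fun i => ht i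
  rw [h1, h2]

end ShadowGraph


/-! ## §9 Rows, columns and the exponent table of `P(G₄)`; the geometry of a gluing at a piece -/

namespace ShadowGraph

variable (G₄ : ShadowGraph)

/-- THE TABLE: exponent sum of the letter `g` in the `e`-th gluing relator. -/
def tab (e : Fin G₄.m) (g : G₄.Gen) : ℤ := expo g (G₄.gluingRelator e)

/-- The USED letters `x_(v, i)`, `i < rank (piece v)`, of the pieces `v ∈ R`. -/
def cols (R : Finset (Fin G₄.k)) : Finset G₄.Gen :=
  ((R ×ˢ (Finset.univ : Finset (Fin 5))).filter fun p => (p.2 : ℕ) < (G₄.piece p.1).rank).map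
    ⟨Sum.inl, Sum.inl_injective⟩

/-- Membership in the used letters of `R`. -/
theorem mem_cols_iff₄ (R : Finset (Fin G₄.k)) (g : G₄.Gen) :
    g ∈ G₄.cols R ↔ ∃ v i, g = Sum.inl (v, i) ∧ v ∈ R ∧ (i : ℕ) < (G₄.piece v).rank := by
  constructor
  · intro h
    simp only [cols, Finset.mem_map, Finset.mem_filter, Finset.mem_product, Finset.mem_univ, and_true,
      Function.Embedding.coeFn_mk] at h
    obtain ⟨⟨v, i⟩, ⟨hv, hi⟩, rfl⟩ := h
    exact ⟨v, i, rfl, hv, hi⟩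
  · rintro ⟨v, i, rfl, hv, hi⟩
    simp only [cols, Finset.mem_map, Finset.mem_filter, Finset.mem_product, Finset.mem_univ, and_true,
      Function.Embedding.coeFn_mk]
    exact ⟨(v, i), ⟨hv, hi⟩, rfl⟩

/-- A spine letter `x_(v, i)` is a used letter of `R` iff `v ∈ R` and `i < rank (piece v)`. -/
theorem inl_mem_cols (R : Finset (Fin G₄.k)) (v : Fin G₄.k) (i : Fin 5) :
    (Sum.inl (v, i) : G₄.Gen) ∈ G₄.cols R ↔ v ∈ R ∧ (i : ℕ) < (G₄.piece v).rank := by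
  rw [mem_cols_iff₄]
  constructor
  · rintro ⟨v', i', h, hv, hi⟩
    simp only [Sum.inl.injEq, Prod.mk.injEq] at h
    obtain ⟨rfl, rfl⟩ := h
    exact ⟨hv, hi⟩
  · rintro ⟨hv, hi⟩
    exact ⟨v, i, rfl, hv, hi⟩

/-- Stable letters are never used spine letters. -/
theorem inr_not_mem_cols₄ (R : Finset (Fin G₄.k)) (e : Fin G₄.m) : (Sum.inr e : G₄.Gen) ∉ G₄.cols R := by
  rw [mem_cols_iff₄]
  rintro ⟨v, i, h, -⟩
  cases h

/-- The used letters are monotone in `R`. -/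
theorem cols_mono₄ {R R' : Finset (Fin G₄.k)} (h : R ⊆ R') : G₄.cols R ⊆ G₄.cols R' := by
  intro g hg
  rw [mem_cols_iff₄] at hg ⊢
  obtain ⟨v, i, rfl, hv, hi⟩ := hg
  exact ⟨v, i, rfl, h hv, hi⟩

/-- No pieces, no used letters. -/
theorem cols_empty₄ : G₄.cols ∅ = ∅ := by
  ext g; simp [mem_cols_iff₄]

/-- The used letters of `R` split into those of `u ∈ R` and those of `R ∖ u`. -/
theorem cols_eq_union₄ (R : Finset (Fin G₄.k)) (u : Fin G₄.k) (hu : u ∈ R) :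
    G₄.cols R = G₄.cols {u} ∪ G₄.cols (R.erase u) := by
  ext g
  rw [Finset.mem_union, mem_cols_iff₄, mem_cols_iff₄, mem_cols_iff₄]
  constructor
  · rintro ⟨v, i, rfl, hv, hi⟩
    by_cases hvu : v = u
    · exact Or.inl ⟨v, i, rfl, by simp [hvu], hi⟩
    · exact Or.inr ⟨v, i, rfl, Finset.mem_erase.mpr ⟨hvu, hv⟩, hi⟩
  · rintro (⟨v, i, rfl, hv, hi⟩ | ⟨v, i, rfl, hv, hi⟩)
    · rw [Finset.mem_singleton] at hv
      exact ⟨v, i, rfl, hv ▸ hu, hi⟩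
    · exact ⟨v, i, rfl, Finset.mem_of_mem_erase hv, hi⟩

/-- The used letters of `u` and of `R ∖ u` are disjoint. -/
theorem cols_disjoint₄ (R : Finset (Fin G₄.k)) (u : Fin G₄.k) : Disjoint (G₄.cols {u}) (G₄.cols (R.erase u)) := by
  rw [Finset.disjoint_left]
  intro g h1 h2
  rw [mem_cols_iff₄] at h1 h2
  obtain ⟨v, i, rfl, hv, -⟩ := h1
  obtain ⟨v', i', h, hv', -⟩ := h2
  simp only [Sum.inl.injEq, Prod.mk.injEq] at h
  obtain ⟨rfl, rfl⟩ := h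
  rw [Finset.mem_singleton] at hv
  exact (Finset.mem_erase.mp hv').1 hv

/-- No letter of `u` is a used letter of `R ∖ u`. -/
theorem inl_not_mem_cols_erase (R : Finset (Fin G₄.k)) (u : Fin G₄.k) (i : Fin 5) :
    (Sum.inl (u, i) : G₄.Gen) ∉ G₄.cols (R.erase u) := by
  rw [inl_mem_cols]
  simp

/-- The piece `u` has `rank (piece u)` used letters. -/
theorem cols_singleton_card₄ (u : Fin G₄.k) : (G₄.cols {u}).card = (G₄.piece u).rank := by
  have key : G₄.cols {u} =
      (Finset.univ.filter fun i : Fin 5 => (i : ℕ) < (G₄.piece u).rank).image fun i => (Sum.inl (u, i) : G₄.Gen) := by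
    ext g
    rw [mem_cols_iff₄, Finset.mem_image]
    constructor
    · rintro ⟨v, i, rfl, hv, hi⟩
      rw [Finset.mem_singleton] at hv
      subst hv
      exact ⟨i, by simp [hi], rfl⟩
    · rintro ⟨i, hi, rfl⟩
      exact ⟨u, i, rfl, Finset.mem_singleton_self u, by simpa using hi⟩
  rw [key, Finset.card_image_of_injective _ (fun i j h => by simpa using h)]
  have h2 := rank_le_five (G₄.piece u)
  generalize (G₄.piece u).rank = r at h2 ⊢
  interval_cases r <;> decide

/-- The ROWS of a peeling state: gluings with both end pieces in `R ∪ L` and at least one in `R`. -/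
def rows (R L : Finset (Fin G₄.k)) : Finset (Fin G₄.m) :=
  Finset.univ.filter fun e =>
    ((G₄.src e).1 ∈ R ∧ ((G₄.tgt e).1 ∈ R ∨ (G₄.tgt e).1 ∈ L)) ∨ ((G₄.tgt e).1 ∈ R ∧ ((G₄.src e).1 ∈ R ∨ (G₄.src e).1 ∈ L))

/-- Membership in the rows of a peeling state. -/
theorem mem_rows₄ (R L : Finset (Fin G₄.k)) (e : Fin G₄.m) :
    e ∈ G₄.rows R L ↔ ((G₄.src e).1 ∈ R ∧ ((G₄.tgt e).1 ∈ R ∨ (G₄.tgt e).1 ∈ L)) ∨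
      ((G₄.tgt e).1 ∈ R ∧ ((G₄.src e).1 ∈ R ∨ (G₄.src e).1 ∈ L)) := by
  simp [rows]

/-- No pieces to peel, no rows. -/
theorem rows_empty₄ (L : Finset (Fin G₄.k)) : G₄.rows ∅ L = ∅ := by
  ext e; simp [mem_rows₄]

end ShadowGraph

end Summit.SmoothPoincare4.SmoothPoincare4.Theorems.RootDecompAEDoublesBeyondShadowTwoStubLedgerFour
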